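import Literature.Computability.QuantumComplexity.ZXCalculus
import HarnessLib

/-!
# The ZW-calculus and `ZW_{1/2}` (Hadzihasanovic 2015; Jeandel–Perdrix–Vilmart 2018 §4)

Topic `Literature/Computability/QuantumComplexity`. The third-party language of the completeness
proof of `ZX_{π/4}` (JPV18 Thm 1, `JeandelPerdrixVilmart2018_completeness` in `ZXCalculus`):

1. **Diagrams and interpretation** (JPV18 §4.1 = the *expanded* ZW-calculus of Hadzihasanovic,
   LICS 2015, read with time flowing top to bottom, plus the scalar generator `½` of JPV18 §4.3).
   `ZWDiagram n m` is the TERM syntax over JPV's generators `T_{1/2}`: the black binary vertex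
   `W-1-1` (`wNot`, `⟦·⟧ = NOT`), the black ternary vertex `W-1-2` (`wSplit`,
   `|0⟩ ↦ |01⟩ + |10⟩`, `|1⟩ ↦ |00⟩`), the white binary vertex `Z-1-1` (`zPhase`, `diag(1,-1)`),
   the white ternary vertex `Z-2-1` (`zMerge`, `|00⟩ ↦ |0⟩`, `|11⟩ ↦ -|1⟩`), the crossing
   (`cross`, the symmetry with a sign `-1` on `|11⟩`), the scalar `half`, identities, the
   symmetric braiding `σ`, cup and cap, closed under the two compositions. `interp` is the
   standard interpretation (JPV18 §4.1), valued here in complex matrices indexed by the tree's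
   registers `QReg` (the entries are dyadic rationals; integers for `half`-free diagrams — the
   inclusion `ℤ ⊂ ℂ` is injective, so equality of interpretations is Hadzihasanovic's).
2. **The calculus** (Hadzihasanovic 2015, Rules 0–7 and X, Def. "expanded ZW calculus";
   reprinted time-reversed as JPV18 Fig. 2, which adds the Reidemeister rules R₂, R₃ for the
   crossing, and — for `ZW_{1/2}` — rule (iv) `◯ ⊗ ½ = empty`, JPV18 Def. 1). `ZWDiagram.Rule`:
   the laws of the free self-dual compact closed PROP `SD` (Hadzihasanovic 2015 §2: strict
   symmetric monoidal laws, naturality of `σ`, snake equations, symmetry of cup and cap — the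
   same structural block as `ZXDiagram.Rule`) and the 25 equations 0a–0d', 1a–1d, 2a, 2b, 3a, 3b,
   4, 5a–5d, 6a–6c, 7a, 7b, X, R₂, R₃, each transcribed from the TikZ sources of both papers
   (arXiv:1501.07082 `img/4*_rule*.tikz`; arXiv:1705.11151v2 `figures/ZW-rule-*.tikz`) and checked
   numerically sound; `ZWDiagram.HalfRule` adds (iv). `ZWStep R` = one rule of `R` applied in
   either direction inside a context; `ZWEquivalent` (`ZW ⊢ D = D'`), `ZWhEquivalent`
   (`ZW_{1/2} ⊢ D = D'`).
3. **Completeness of ZW** (Hadzihasanovic 2015, Thm: `F : SD[T/ZW] → Ab_{2,free}` is a monoidal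
   equivalence; quoted as JPV18 §4.2 / LMCS Thm "[zw]") reads here: `half`-free terms with the
   same interpretation are `ZWEquivalent`. It is NOT assumed: it is proved (normal forms) in the
   companion file `ZWCalculusCompleteness`, and `ZW_{1/2}`-completeness (JPV18 Prop 1) from it.

## Faithfulness of the encoding

Hadzihasanovic's generators are the vertices as *states* `0 → 2`, `0 → 3` in the free compact
closed PROP, all other forms being bendings; his Rule 0 (symmetry of the vertices) lets one
"treat the vertices as vertices of an undirected graph" (his Remark after Rule 0). Here JPV's
bent forms `W-1-1, W-1-2, Z-1-1, Z-2-1` are the primitive constructors and the other bendings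
are the derived terms `wMerge, zSplit, blackEffect₂/₃, whiteEffect₂/₃, …` below (cups, caps and
`σ` applied to the primitives); Rule 0 is stated for the effect forms (two transpositions
generating `S₃`), so that, exactly as in `SD[T/ZW]`, all bendings and leg orderings of a vertex
are inter-derivable. JPV read Hadzihasanovic's pictures with time reversed: a JPV term `D`
denotes the transpose of the corresponding ZW morphism, all generator matrices being real, so
`ZW ⊢ D₁ = D₂` here iff Hadzihasanovic's calculus proves `D₁ᵀ = D₂ᵀ`; every rule below is the
transpose of his (e.g. his black monoid `(N ∘ w₃^{2→1}, N ∘ looped w₃)` appears as the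
comultiplication `blackDelta = wNot ⨾ wSplit` with counit `blackCounit`). The extra sound rules
R₂, R₃ of JPV's Fig. 2 can only enlarge derivability, so completeness of this table is implied by (and,
on Hadzihasanovic's rule instances, is) the published theorem.

## References

* A. Hadzihasanovic, *A diagrammatic axiomatisation for qubit entanglement*, LICS 2015
  (arXiv:1501.07082), §2–3 (SD[T/ZW], Rules 0–7, X), Thm (completeness for `Ab_{2,free}`)
  [Hadzihasanovic2015].
* E. Jeandel, S. Perdrix, R. Vilmart, *A complete axiomatisation of the ZX-calculus for
  Clifford+T quantum mechanics*, LICS 2018 (arXiv:1705.11151v2), §4, Fig. 2, Def. 1, Prop. 1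
  [JeandelPerdrixVilmart2018]; full version LMCS 16(2):11 (2020), §3.

## Design notes / not here

* Registers, `tens`, `QReg` are the tree's (`ZXCalculus`); scalars `0 → 0` as there.
* Not here (companion files): soundness of the rules; `ZW_{1/2}` completeness (JPV18 Prop 1);
  the translations `⟦·⟧_XW`, `⟦·⟧_WX` (JPV18 §5–6).
-/
noncomputable section

namespace Literature.Computability.QuantumComplexity

open Literature.Computability.Cryptography
open Matrix

/-- **ZW-diagrams** (terms of `ZW_{1/2}`) with `n` inputs and `m` outputs over JPV's generators
`T_{1/2}`: identities, the symmetric braiding, cup, cap, the black binary and ternary vertices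
`W-1-1 : 1 → 1`, `W-1-2 : 1 → 2`, the white binary and ternary vertices `Z-1-1 : 1 → 1`,
`Z-2-1 : 2 → 1`, the crossing `2 → 2`, the scalar `½ : 0 → 0`, and the two compositions.
[cite: JeandelPerdrixVilmart2018, §4.1 and Def. 1] -/
inductive ZWDiagram : ℕ → ℕ → Type
  /-- `n` parallel wires; `wires 0` is the empty diagram. -/
  | wires (n : ℕ) : ZWDiagram n n
  /-- The symmetric braiding `σ` of two wires. -/
  | swap : ZWDiagram 2 2
  /-- The cup `η : 0 → 2`. -/
  | cup : ZWDiagram 0 2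
  /-- The cap `ε : 2 → 0`. -/
  | cap : ZWDiagram 2 0
  /-- The black binary vertex `W-1-1` (`⟦·⟧ = NOT`). -/
  | wNot : ZWDiagram 1 1
  /-- The black ternary vertex `W-1-2` (`|0⟩ ↦ |01⟩ + |10⟩`, `|1⟩ ↦ |00⟩`). -/
  | wSplit : ZWDiagram 1 2
  /-- The white binary vertex `Z-1-1` (`diag(1, -1)`). -/
  | zPhase : ZWDiagram 1 1
  /-- The white ternary vertex `Z-2-1` (`|00⟩ ↦ |0⟩`, `|11⟩ ↦ -|1⟩`, `0` otherwise). -/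
  | zMerge : ZWDiagram 2 1
  /-- The crossing (JPV's `zw-cross`): the braiding with a sign `-1` on `|11⟩`. -/
  | cross : ZWDiagram 2 2
  /-- The scalar `½` of `ZW_{1/2}`. -/
  | half : ZWDiagram 0 0
  /-- Sequential composition: `seq A B` is `A` then `B` (JPV's `B ∘ A`). -/
  | seq {n m k : ℕ} (A : ZWDiagram n m) (B : ZWDiagram m k) : ZWDiagram n k
  /-- Spatial composition `A ⊗ B`, `A` on the first wires. -/
  | par {n m n' m' : ℕ} (A : ZWDiagram n m) (B : ZWDiagram n' m') : ZWDiagram (n + n') (m + m')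

namespace ZWDiagram

/-- `A ⨾ B`: sequential composition of ZW-terms, `A` then `B`. -/
scoped notation:60 A:60 " ⨾ " B:61 => (ZWDiagram.seq (A :) (B :) :)
/-- `A ⊗ B`: spatial composition of ZW-terms, `A` on the first wires. -/
scoped notation:70 A:70 " ⊗ " B:71 => (ZWDiagram.par (A :) (B :) :)

variable {n m k n' m' : ℕ}

/-! ### Standard interpretation (JPV18 §4.1) -/

/-- `⟦W-1-1⟧ = NOT`. [cite: JeandelPerdrixVilmart2018, §4.1] -/
def wNotMat : Matrix (QReg 1) (QReg 1) ℂ := Matrix.of fun y x => if y 0 = x 0 then 0 else 1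

/-- `⟦W-1-2⟧`: `|0⟩ ↦ |01⟩ + |10⟩`, `|1⟩ ↦ |00⟩`. [cite: JeandelPerdrixVilmart2018, §4.1] -/
def wSplitMat : Matrix (QReg 2) (QReg 1) ℂ := Matrix.of fun y x =>
  if x 0 then (if y 0 = false ∧ y 1 = false then 1 else 0) else (if y 0 = y 1 then 0 else 1)

/-- `⟦Z-1-1⟧ = diag(1, -1)`. [cite: JeandelPerdrixVilmart2018, §4.1] -/
def zPhaseMat : Matrix (QReg 1) (QReg 1) ℂ := Matrix.of fun y x =>
  if y 0 = x 0 then (if x 0 then -1 else 1) else 0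

/-- `⟦Z-2-1⟧`: `|00⟩ ↦ |0⟩`, `|11⟩ ↦ -|1⟩`, `|01⟩, |10⟩ ↦ 0`. [cite: JeandelPerdrixVilmart2018, §4.1] -/
def zMergeMat : Matrix (QReg 1) (QReg 2) ℂ := Matrix.of fun y x =>
  if x 0 = false ∧ x 1 = false ∧ y 0 = false then 1
  else if x 0 = true ∧ x 1 = true ∧ y 0 = true then -1 else 0

/-- `⟦crossing⟧ = |00⟩⟨00| + |01⟩⟨10| + |10⟩⟨01| - |11⟩⟨11|`. [cite: JeandelPerdrixVilmart2018, §4.1] -/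
def crossMat : Matrix (QReg 2) (QReg 2) ℂ := Matrix.of fun y x =>
  if y 0 = x 1 ∧ y 1 = x 0 then (if x 0 = true ∧ x 1 = true then -1 else 1) else 0

/-- **The standard interpretation** `⟦D⟧` of a ZW-term `D : n → m`: a complex `2^m × 2^n`
matrix indexed by registers (rows = outputs), whose entries lie in `ℤ[1/2]` (in `ℤ` for
`half`-free terms). [cite: JeandelPerdrixVilmart2018, §4.1 and Def. 1] -/
def interp : {n m : ℕ} → ZWDiagram n m → Matrix (QReg m) (QReg n) ℂ
  | _, _, wires _ => 1
  | _, _, swap => Matrix.of fun y x => if y 0 = x 1 ∧ y 1 = x 0 then 1 else 0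
  | _, _, cup => Matrix.of fun y _ => if y 0 = y 1 then 1 else 0
  | _, _, cap => Matrix.of fun _ x => if x 0 = x 1 then 1 else 0
  | _, _, wNot => wNotMat
  | _, _, wSplit => wSplitMat
  | _, _, zPhase => zPhaseMat
  | _, _, zMerge => zMergeMat
  | _, _, cross => crossMat
  | _, _, half => Matrix.of fun _ _ => (2 : ℂ)⁻¹
  | _, _, .seq A B => interp B * interp A
  | _, _, .par A B => ZXDiagram.tens (interp A) (interp B)

/-- `⟦𝕀^{⊗n}⟧ = 1`. [cite: JeandelPerdrixVilmart2018, §4.1] -/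
@[simp] theorem interp_wires : interp (ZWDiagram.wires n) = 1 := rfl
/-- `⟦A ⨾ B⟧ = ⟦B⟧⟦A⟧`. [cite: JeandelPerdrixVilmart2018, §4.1] -/
@[simp] theorem interp_seq (A : ZWDiagram n m) (B : ZWDiagram m k) : interp (A ⨾ B) = interp B * interp A := rfl
/-- `⟦A ⊗ B⟧ = ⟦A⟧ ⊗ ⟦B⟧`. [cite: JeandelPerdrixVilmart2018, §4.1] -/
@[simp] theorem interp_par (A : ZWDiagram n m) (B : ZWDiagram n' m') :
    interp (A ⊗ B) = ZXDiagram.tens (interp A) (interp B) := rfl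
/-- `⟦W-1-1⟧` (definitional). [cite: JeandelPerdrixVilmart2018, §4.1] -/
@[simp] theorem interp_wNot : interp wNot = wNotMat := rfl
/-- `⟦W-1-2⟧` (definitional). [cite: JeandelPerdrixVilmart2018, §4.1] -/
@[simp] theorem interp_wSplit : interp wSplit = wSplitMat := rfl
/-- `⟦Z-1-1⟧` (definitional). [cite: JeandelPerdrixVilmart2018, §4.1] -/
@[simp] theorem interp_zPhase : interp zPhase = zPhaseMat := rfl
/-- `⟦Z-2-1⟧` (definitional). [cite: JeandelPerdrixVilmart2018, §4.1] -/
@[simp] theorem interp_zMerge : interp zMerge = zMergeMat := rfl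
/-- `⟦crossing⟧` (definitional). [cite: JeandelPerdrixVilmart2018, §4.1] -/
@[simp] theorem interp_cross : interp cross = crossMat := rfl
/-- `⟦½⟧ = (1/2)`. [cite: JeandelPerdrixVilmart2018, Def. 1] -/
theorem interp_half_apply (y x : QReg 0) : interp half y x = (2 : ℂ)⁻¹ := rfl

/-- The scalar `⟦D⟧ ∈ ℂ` of a closed ZW-term `D : 0 → 0`. [cite: JeandelPerdrixVilmart2018, §4.1] -/
def scalar (D : ZWDiagram 0 0) : ℂ := interp D Fin.elim0 Fin.elim0

/-- `⟦½⟧ = 1/2`. [cite: JeandelPerdrixVilmart2018, Def. 1] -/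
@[simp] theorem scalar_half : scalar half = (2 : ℂ)⁻¹ := rfl

/-! ### Casts and block crossings -/

/-- Transport along equalities of wire counts (as `ZXDiagram.cast`). [folklore] -/
def cast (D : ZWDiagram n m) (hn : n = n') (hm : m = m') : ZWDiagram n' m' := hn ▸ hm ▸ D

/-- Casting along `rfl` is the identity. [folklore] -/
@[simp] theorem cast_rfl (D : ZWDiagram n m) : D.cast rfl rfl = D := rfl

/-- The interpretation of a cast is the reindexed interpretation. [folklore] -/
theorem interp_cast (D : ZWDiagram n m) (hn : n = n') (hm : m = m') :
    interp (D.cast hn hm) =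
      (interp D).submatrix (fun y => y ∘ Fin.cast hm) (fun x => x ∘ Fin.cast hn) := by
  subst hn; subst hm; rfl

/-- The braiding of the last wire over the first `n` wires, built from `σ` (as
`ZXDiagram.bswap1`). [folklore] -/
def bswap1 : (n : ℕ) → ZWDiagram (n + 1) (1 + n)
  | 0 => wires 1
  | n + 1 => (wires n ⊗ swap) ⨾ (bswap1 n ⊗ wires 1)

/-! ### Bendings of the vertices (Hadzihasanovic's "undirected" vertices) -/

/-- The black ternary vertex as `2 → 1` (transpose of `W-1-2` by a cap). [cite: Hadzihasanovic2015, Rule 0 and Remark] -/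
def wMerge : ZWDiagram 2 1 := (wSplit ⊗ wires 1) ⨾ (wires 1 ⊗ cap)

/-- The white ternary vertex as `1 → 2` (transpose of `Z-2-1` by a cup). [cite: Hadzihasanovic2015, Rule 0 and Remark] -/
def zSplit : ZWDiagram 1 2 := (cup ⊗ wires 1) ⨾ (wires 1 ⊗ zMerge)

/-- JPV's black "dot with a loop" effect `1 → 0` (`= ⟨1|`): `W-1-2` with its outputs capped.
[cite: JeandelPerdrixVilmart2018, §4.2 (shortcut `black-dot-0-1`)] -/
def blackLoopEffect : ZWDiagram 1 0 := wSplit ⨾ cap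

/-- The black "dot with a loop" state `0 → 1` (`= |1⟩`): a cup into the black ternary vertex.
[cite: JeandelPerdrixVilmart2018, §4.2] -/
def blackLoopState : ZWDiagram 0 1 := cup ⨾ wMerge

/-- JPV's white "dot with a loop" effect `1 → 0` (`= ⟨0| - ⟨1|`). [cite: JeandelPerdrixVilmart2018, §4.2 (shortcut `white-dot-0-1`)] -/
def whiteLoopEffect : ZWDiagram 1 0 := zSplit ⨾ cap

/-- The black binary vertex as an effect `2 → 0`. [cite: Hadzihasanovic2015, Rule 0a] -/
def blackEffect₂ : ZWDiagram 2 0 := (wNot ⊗ wires 1) ⨾ cap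

/-- The black ternary vertex as an effect `3 → 0`. [cite: Hadzihasanovic2015, Rule 0b] -/
def blackEffect₃ : ZWDiagram 3 0 := (wSplit ⊗ wires 2) ⨾ ((wires 1 ⊗ cap) ⊗ wires 1) ⨾ cap

/-- The white binary vertex as an effect `2 → 0`. [cite: Hadzihasanovic2015, Rule 0c] -/
def whiteEffect₂ : ZWDiagram 2 0 := (zPhase ⊗ wires 1) ⨾ cap

/-- The white ternary vertex as an effect `3 → 0`. [cite: Hadzihasanovic2015, Rule 0d] -/
def whiteEffect₃ : ZWDiagram 3 0 := (zMerge ⊗ wires 1) ⨾ cap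

/-- Hadzihasanovic's black monoid multiplication `N ∘ w₃^{2→1}`, time-reversed: the
comultiplication `W-1-1 ⨾ W-1-2` (`|0⟩ ↦ |00⟩`, `|1⟩ ↦ |01⟩ + |10⟩`). [cite: Hadzihasanovic2015, Rule 1] -/
def blackDelta : ZWDiagram 1 2 := wNot ⨾ wSplit

/-- Hadzihasanovic's black unit, time-reversed: the counit `⟨0|`. [cite: Hadzihasanovic2015, Rule 1] -/
def blackCounit : ZWDiagram 1 0 := wNot ⨾ blackLoopEffect

/-- Hadzihasanovic's black counit, time-reversed: the unit `|0⟩`. [cite: Hadzihasanovic2015, Rule 5] -/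
def blackUnit : ZWDiagram 0 1 := blackLoopState ⨾ wNot

/-- Hadzihasanovic's black comultiplication `w₃^{1→2} ∘ N`, time-reversed: `2 → 1`. [cite: Hadzihasanovic2015, Rule 5] -/
def blackNabla : ZWDiagram 2 1 := wMerge ⨾ wNot

/-- Hadzihasanovic's white monoid multiplication `Z ∘ z₃^{2→1}`, time-reversed: the copy
`|x⟩ ↦ |xx⟩`. [cite: Hadzihasanovic2015, Rule 1] -/
def whiteDelta : ZWDiagram 1 2 := zPhase ⨾ zSplit

/-- Hadzihasanovic's white unit, time-reversed: the counit `⟨0| + ⟨1|`. [cite: Hadzihasanovic2015, Rule 1] -/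
def whiteCounit : ZWDiagram 1 0 := zPhase ⨾ whiteLoopEffect

/-- Hadzihasanovic's white comultiplication, time-reversed: `2 → 1`, `|xx⟩ ↦ |x⟩`. [cite: Hadzihasanovic2015, Rule 4] -/
def whiteNabla : ZWDiagram 2 1 := zMerge ⨾ zPhase

/-- The circle `η ⨾ ε` (the scalar `2`). [cite: JeandelPerdrixVilmart2018, Def. 1] -/
def circle : ZWDiagram 0 0 := cup ⨾ cap

/-! ### The rule tables -/

/-- **The axioms of ZW** as oriented pairs (used in both directions by `ZWStep`): the laws of
the free self-dual compact closed PROP (strict symmetric monoidal structure of terms,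
naturality of `σ`, snakes, symmetry of cup and cap) [Hadzihasanovic 2015 §2], Hadzihasanovic's
Rules 0–7 and X of the expanded ZW-calculus, time-reversed [Hadzihasanovic 2015 §3;
JPV18 Fig. 2], and JPV's Reidemeister rules R₂, R₃ for the crossing [JPV18 Fig. 2].
[cite: Hadzihasanovic2015, Rules 0–7, X; JeandelPerdrixVilmart2018, Fig. 2] -/
inductive Rule : {n m : ℕ} → ZWDiagram n m → ZWDiagram n m → Prop
  -- strict symmetric monoidal structure of terms
  | seq_assoc {n m k l : ℕ} (A : ZWDiagram n m) (B : ZWDiagram m k) (C : ZWDiagram k l) :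
      Rule ((A ⨾ B) ⨾ C) (A ⨾ (B ⨾ C))
  | id_seq {n m : ℕ} (A : ZWDiagram n m) : Rule (wires n ⨾ A) A
  | seq_id {n m : ℕ} (A : ZWDiagram n m) : Rule (A ⨾ wires m) A
  | par_assoc {n m n' m' n'' m'' : ℕ} (A : ZWDiagram n m) (B : ZWDiagram n' m')
      (C : ZWDiagram n'' m'') :
      Rule ((A ⊗ B) ⊗ C)
        ((A ⊗ (B ⊗ C)).cast (Nat.add_assoc n n' n'').symm (Nat.add_assoc m m' m'').symm)
  | empty_par {n m : ℕ} (A : ZWDiagram n m) :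
      Rule (wires 0 ⊗ A) (A.cast (Nat.zero_add n).symm (Nat.zero_add m).symm)
  | par_empty {n m : ℕ} (A : ZWDiagram n m) : Rule (A ⊗ wires 0) A
  | interchange {n m k n' m' k' : ℕ} (A : ZWDiagram n m) (B : ZWDiagram m k)
      (C : ZWDiagram n' m') (D : ZWDiagram m' k') :
      Rule ((A ⊗ C) ⨾ (B ⊗ D)) ((A ⨾ B) ⊗ (C ⨾ D))
  | id_par_id (n m : ℕ) : Rule (wires n ⊗ wires m) (wires (n + m))
  | swap_swap : Rule (swap ⨾ swap) (wires 2)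
  | swap_nat {n m : ℕ} (A : ZWDiagram n m) :
      Rule ((A ⊗ wires 1) ⨾ bswap1 m) (bswap1 n ⨾ (wires 1 ⊗ A))
  -- self-dual compact structure
  | snake_left : Rule ((wires 1 ⊗ cup) ⨾ (cap ⊗ wires 1)) (wires 1)
  | snake_right : Rule ((cup ⊗ wires 1) ⨾ (wires 1 ⊗ cap)) (wires 1)
  | cup_swap : Rule (cup ⨾ swap) cup
  | swap_cap : Rule (swap ⨾ cap) cap
  -- Rule 0: the vertices are symmetric (0a, 0b, 0b', 0c, 0d, 0d')
  | black₂_symm : Rule (swap ⨾ blackEffect₂) blackEffect₂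
  | black₃_symm_left : Rule ((swap ⊗ wires 1) ⨾ blackEffect₃) blackEffect₃
  | black₃_symm_right : Rule ((wires 1 ⊗ swap) ⨾ blackEffect₃) blackEffect₃
  | white₂_symm : Rule (swap ⨾ whiteEffect₂) whiteEffect₂
  | white₃_symm_left : Rule ((swap ⊗ wires 1) ⨾ whiteEffect₃) whiteEffect₃
  | white₃_symm_right : Rule ((wires 1 ⊗ swap) ⨾ whiteEffect₃) whiteEffect₃
  -- Rule 1: black and white (co)monoids (1a, 1b, 1c, 1d)
  | black_coassoc : Rule (blackDelta ⨾ (blackDelta ⊗ wires 1)) (blackDelta ⨾ (wires 1 ⊗ blackDelta))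
  | black_counit : Rule (blackDelta ⨾ (blackCounit ⊗ wires 1)) (wires 1)
  | white_coassoc : Rule (whiteDelta ⨾ (whiteDelta ⊗ wires 1)) (whiteDelta ⨾ (wires 1 ⊗ whiteDelta))
  | white_counit : Rule (whiteDelta ⨾ (whiteCounit ⊗ wires 1)) (wires 1)
  -- Rule 2: the binary vertices are involutions (2a, 2b)
  | wNot_wNot : Rule (wNot ⨾ wNot) (wires 1)
  | zPhase_zPhase : Rule (zPhase ⨾ zPhase) (wires 1)
  -- Rule 3: each binary vertex is an automorphism of the other colour (3a, 3b)
  | wNot_white : Rule (whiteDelta ⨾ (wNot ⊗ wNot)) (wNot ⨾ whiteDelta)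
  | zPhase_black : Rule (blackDelta ⨾ (zPhase ⊗ zPhase)) (zPhase ⨾ blackDelta)
  -- Rule 4: the white Frobenius law
  | white_frobenius : Rule (whiteNabla ⨾ whiteDelta) ((wires 1 ⊗ whiteDelta) ⨾ (whiteNabla ⊗ wires 1))
  -- Rule 5: the black Hopf algebra with antipode `Z-1-1` (5a, 5b, 5c, 5d)
  | black_bialgebra : Rule (blackNabla ⨾ blackDelta)
      ((blackDelta ⊗ blackDelta) ⨾ ((wires 1 ⊗ cross) ⊗ wires 1) ⨾ (blackNabla ⊗ blackNabla))
  | black_counit_nabla : Rule (blackNabla ⨾ blackCounit) (blackCounit ⊗ blackCounit)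
  | black_unit_counit : Rule (blackLoopState ⨾ wNot ⨾ wNot ⨾ blackLoopEffect) (wires 0)
  | black_antipode : Rule (wNot ⨾ wSplit ⨾ (wires 1 ⊗ zPhase) ⨾ wMerge ⨾ wNot) (blackCounit ⨾ blackUnit)
  -- Rule 6: the mixed "Hopf algebra" with trivial antipode (6a, 6b, 6c)
  | mixed_bialgebra : Rule (whiteNabla ⨾ blackDelta)
      ((blackDelta ⊗ blackDelta) ⨾ ((wires 1 ⊗ cross) ⊗ wires 1) ⨾ (whiteNabla ⊗ whiteNabla))
  | white_counit_nabla : Rule (whiteNabla ⨾ blackCounit) (blackCounit ⊗ blackCounit)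
  | mixed_antipode : Rule (wNot ⨾ wSplit ⨾ zMerge ⨾ zPhase) (blackCounit ⨾ blackUnit)
  -- Rule 7: the black multiplication is even, the black binary vertex is odd (7a, 7b)
  | cross_blackDelta : Rule (cross ⨾ (wires 1 ⊗ blackDelta))
      ((blackDelta ⊗ wires 1) ⨾ (wires 1 ⊗ cross) ⨾ (cross ⊗ wires 1))
  | cross_wNot : Rule (cross ⨾ (wires 1 ⊗ wNot)) ((wNot ⊗ zPhase) ⨾ cross)
  -- Rule X: elimination of crossings
  | cross_elim : Rule (blackDelta ⨾ (whiteDelta ⊗ whiteDelta) ⨾ ((wires 1 ⊗ cross) ⊗ wires 1))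
      (blackDelta ⨾ (whiteDelta ⊗ whiteDelta) ⨾ ((wires 1 ⊗ swap) ⊗ wires 1))
  -- JPV's Reidemeister rules for the crossing (R₂, R₃)
  | cross_cross : Rule (cross ⨾ cross) (wires 2)
  | cross_yangBaxter : Rule ((wires 1 ⊗ cross) ⨾ (cross ⊗ wires 1) ⨾ (wires 1 ⊗ cross))
      ((cross ⊗ wires 1) ⨾ (wires 1 ⊗ cross) ⨾ (cross ⊗ wires 1))

/-- **The axioms of `ZW_{1/2}`**: those of ZW together with rule (iv) `◯ ⊗ ½ = ` empty, binding
the scalar `½`. [cite: JeandelPerdrixVilmart2018, Def. 1 and Fig. 2] -/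
inductive HalfRule : {n m : ℕ} → ZWDiagram n m → ZWDiagram n m → Prop
  | zw {n m : ℕ} {l r : ZWDiagram n m} : Rule l r → HalfRule l r
  | circle_half : HalfRule (circle ⊗ half) (wires 0)

end ZWDiagram

open ZWDiagram

/-! ### Rewriting -/

/-- **One rewrite step** for a rule table `R` on ZW-terms: an axiom applied in either direction
to a sub-term (closure of `R ∪ R⁻¹` under the two compositions). [cite: JeandelPerdrixVilmart2018, §4.2] -/
inductive ZWStep (R : ∀ {n m : ℕ}, ZWDiagram n m → ZWDiagram n m → Prop) :
    {n m : ℕ} → ZWDiagram n m → ZWDiagram n m → Prop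
  | rule {n m : ℕ} {l r : ZWDiagram n m} : R l r → ZWStep R l r
  | rule_symm {n m : ℕ} {l r : ZWDiagram n m} : R l r → ZWStep R r l
  | seq_left {n m k : ℕ} {A A' : ZWDiagram n m} (B : ZWDiagram m k) :
      ZWStep R A A' → ZWStep R (A ⨾ B) (A' ⨾ B)
  | seq_right {n m k : ℕ} (A : ZWDiagram n m) {B B' : ZWDiagram m k} :
      ZWStep R B B' → ZWStep R (A ⨾ B) (A ⨾ B')
  | par_left {n m n' m' : ℕ} {A A' : ZWDiagram n m} (B : ZWDiagram n' m') :
      ZWStep R A A' → ZWStep R (A ⊗ B) (A' ⊗ B)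
  | par_right {n m n' m' : ℕ} (A : ZWDiagram n m) {B B' : ZWDiagram n' m'} :
      ZWStep R B B' → ZWStep R (A ⊗ B) (A ⊗ B')

/-- Rewrite steps are symmetric. [folklore] -/
theorem ZWStep.symm {R : ∀ {n m : ℕ}, ZWDiagram n m → ZWDiagram n m → Prop} {n m : ℕ}
    {D E : ZWDiagram n m} (h : ZWStep R D E) : ZWStep R E D := by
  induction h with
  | rule h => exact .rule_symm h
  | rule_symm h => exact .rule h
  | seq_left B _ ih => exact .seq_left B ih
  | seq_right A _ ih => exact .seq_right A ih
  | par_left B _ ih => exact .par_left B ih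
  | par_right A _ ih => exact .par_right A ih

/-- A step for a rule table is a step for any larger table. [folklore] -/
theorem ZWStep.mono {R R' : ∀ {n m : ℕ}, ZWDiagram n m → ZWDiagram n m → Prop}
    (hRR' : ∀ {n m : ℕ} (l r : ZWDiagram n m), R l r → R' l r) {n m : ℕ}
    {D E : ZWDiagram n m} (h : ZWStep R D E) : ZWStep R' D E := by
  induction h with
  | rule h => exact .rule (hRR' _ _ h)
  | rule_symm h => exact .rule_symm (hRR' _ _ h)
  | seq_left B _ ih => exact .seq_left B ih
  | seq_right A _ ih => exact .seq_right A ih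
  | par_left B _ ih => exact .par_left B ih
  | par_right A _ ih => exact .par_right A ih

/-- `ZW ⊢ D = D'`: inter-derivability with the rules of ZW (the equivalence generated by the
rewrite steps of `ZWDiagram.Rule`). [cite: Hadzihasanovic2015, §2; JeandelPerdrixVilmart2018, §4.2] -/
def ZWEquivalent {n m : ℕ} (D D' : ZWDiagram n m) : Prop :=
  Relation.EqvGen (ZWStep Rule) D D'

/-- `ZW_{1/2} ⊢ D = D'`: inter-derivability with the rules of `ZW_{1/2}`. [cite: JeandelPerdrixVilmart2018, Def. 1] -/
def ZWhEquivalent {n m : ℕ} (D D' : ZWDiagram n m) : Prop :=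
  Relation.EqvGen (ZWStep HalfRule) D D'

/-- A ZW-derivation is a `ZW_{1/2}`-derivation. [cite: JeandelPerdrixVilmart2018, Def. 1] -/
theorem ZWEquivalent.zwh {n m : ℕ} {D D' : ZWDiagram n m} (h : ZWEquivalent D D') :
    ZWhEquivalent D D' :=
  Relation.EqvGen.mono (fun _ _ hs => ZWStep.mono (fun _ _ => HalfRule.zw) hs) D D' h

/-- Terms of the ZW-calculus proper: no occurrence of the scalar `½`. [cite: JeandelPerdrixVilmart2018, §4.3] -/
def ZWDiagram.halfFree : {n m : ℕ} → ZWDiagram n m → Prop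
  | _, _, .half => False
  | _, _, .seq A B => A.halfFree ∧ B.halfFree
  | _, _, .par A B => A.halfFree ∧ B.halfFree
  | _, _, _ => True

end Literature.Computability.QuantumComplexity
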